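import Summits.QuantumAdvantage.QuantumAdvantage.Theses.SosSandwich
import Literature.Computability.QuantumComplexity.InfluenceBounds
import Literature.Computability.Complexity.FourierDegreeAlgebra
import Literature.Computability.Complexity.FourierTails

/-!
# Route `SosSandwich`, support `OneQueryFrameAA` (stmt-QuantumAdvantage-15240) — part 1: Walsh–Fourier bookkeeping at level `≤ 1`

If `p` and `1 - p` are, on the cube, sums of squares of polynomials of total degree `≤ 1`, then
`4·Var[p]² ≤ 9·maxᵢ Infᵢ[p]` (tree conventions: `Inf_i = E (p - p^{⊕i})²`, plain variance).

Proof (flat Gram matrix). On `{±1}^N` write `q_j = α_j(∅) + Σ_i α_j({i}) χ_i` (Fourier level `≤ 1`),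
`r_j` likewise with `γ_j`. The coefficient identities `p = Σ q_j²`, `1 - p = Σ r_j²` give
`p̂({i}) = 2 M(∅,{i})`, `p̂({i,k}) = 2 M({i},{k})` with `M(A,B) = Σ_j α_j(A) α_j(B)`, and FLATNESS:
`G(A,B) := Σ_j (α_j(A)α_j(B) + γ_j(A)γ_j(B)) = 0` for `A ≠ B`, `Σ_A G(A,A) = 1`. Hence for every test vector
`u`, `Σ_j (Σ_A u_A α_j(A))² ≤ Σ_A u_A² d_A` (`d_A = G(A,A)`), and two choices of `u` give
`V₁² ≤ τ` and `V₂ ≤ √τ/2` for the level-1 and level-2 Fourier weights (`τ = max Inf`), so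
`Var = V₁ + V₂ ≤ (3/2)√τ`.
-/

set_option linter.dupNamespace false -- D-0017: single-problem summit ⇒ `QuantumAdvantage.QuantumAdvantage` by design

namespace Summit.QuantumAdvantage.QuantumAdvantage.Theorems.SosSandwich

open Finset MvPolynomial Literature.Computability.QuantumComplexity Literature.Computability.Complexity.LowDegree
  Literature.Probability.RandomGraphs.LowDegree
open scoped symmDiff

variable {N : ℕ}

/-! ### Fourier bookkeeping at level `≤ 1` -/

/-- A polynomial of total degree `≤ 1` has no Fourier weight at sets of size `≥ 2`. [folklore] -/
theorem fc_eq_zero_of_deg_le_one {q : MvPolynomial (Fin N) ℝ} (hq : q.totalDegree ≤ 1)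
    {S : Finset (Fin N)} (hS : 2 ≤ S.card) : cubeFourierCoeff (evalBool q) S = 0 :=
  cubeFourierCoeff_evalBool_eq_zero hq (by omega)

/-- `{k} ∆ {i} = {k, i}` has two elements for `k ≠ i`. [folklore] -/
theorem card_singleton_symmDiff_singleton {i k : Fin N} (h : k ≠ i) :
    (({k} : Finset (Fin N)) ∆ {i}).card = 2 := by
  have : ({k} : Finset (Fin N)) ∆ {i} = {k, i} := by
    ext j
    by_cases h1 : j = k <;> by_cases h2 : j = i <;> simp [Finset.mem_symmDiff, h1, h2, h, h.symm]
  rw [this, Finset.card_pair h]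

/-- `{i} ∆ {i, k} = {k}` for `i ≠ k`. [folklore] -/
theorem singleton_symmDiff_pair {i k : Fin N} (h : i ≠ k) :
    ({i} : Finset (Fin N)) ∆ {i, k} = {k} := by
  ext j
  by_cases h1 : j = i <;> by_cases h2 : j = k <;> simp [Finset.mem_symmDiff, h1, h2, h, h.symm]

/-- `{k} ∆ {i, k} = {i}` for `i ≠ k`. [folklore] -/
theorem singleton_symmDiff_pair' {i k : Fin N} (h : i ≠ k) :
    ({k} : Finset (Fin N)) ∆ {i, k} = {i} := by
  ext j
  by_cases h1 : j = i <;> by_cases h2 : j = k <;> simp [Finset.mem_symmDiff, h1, h2, h, h.symm]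

/-- `{l} ∆ {i, k}` has three elements when `l ∉ {i, k}`, `i ≠ k`. [folklore] -/
theorem card_singleton_symmDiff_pair {i k l : Fin N} (h : i ≠ k) (hl1 : l ≠ i) (hl2 : l ≠ k) :
    3 ≤ (({l} : Finset (Fin N)) ∆ {i, k}).card := by
  have : ({l} : Finset (Fin N)) ∆ {i, k} = {l, i, k} := by
    ext j
    by_cases h1 : j = i <;> by_cases h2 : j = k <;> by_cases h3 : j = l <;>
      simp_all [Finset.mem_symmDiff]
  rw [this, Finset.card_insert_of_notMem (by simp [hl1, hl2]), Finset.card_pair h]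

/-- Convolution at a singleton for two functions of Fourier level `≤ 1`:
`(gh)^({i}) = ĝ(∅) ĥ({i}) + ĝ({i}) ĥ(∅)`. [cite: ODonnell2014, §1.4] -/
theorem fc_mul_singleton {g h : (Fin N → Bool) → ℝ}
    (hg : ∀ S : Finset (Fin N), 2 ≤ S.card → cubeFourierCoeff g S = 0)
    (hh : ∀ S : Finset (Fin N), 2 ≤ S.card → cubeFourierCoeff h S = 0) (i : Fin N) :
    cubeFourierCoeff (fun x => g x * h x) {i} =
      cubeFourierCoeff g ∅ * cubeFourierCoeff h {i} + cubeFourierCoeff g {i} * cubeFourierCoeff h ∅ := by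
  classical
  rw [cubeFourierCoeff_mul]
  have hne : (∅ : Finset (Fin N)) ≠ {i} := (Finset.singleton_ne_empty i).symm
  rw [← Finset.sum_subset (Finset.subset_univ ({∅, {i}} : Finset (Finset (Fin N)))),
    Finset.sum_pair hne]
  · rw [show (∅ : Finset (Fin N)) ∆ {i} = {i} from bot_symmDiff _, symmDiff_self,
      Finset.bot_eq_empty]
  · intro S _ hS
    rw [Finset.mem_insert, Finset.mem_singleton, not_or] at hS
    by_cases h2 : 2 ≤ S.card
    · rw [hg S h2, zero_mul]
    · have hc : S.card = 1 := by
        have : S.card ≠ 0 := by rw [Ne, Finset.card_eq_zero]; exact hS.1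
        omega
      obtain ⟨k, rfl⟩ := Finset.card_eq_one.mp hc
      have hki : k ≠ i := fun e => hS.2 (by rw [e])
      rw [hh _ (by rw [card_singleton_symmDiff_singleton hki]), mul_zero]

/-- Convolution at a pair for two functions of Fourier level `≤ 1`:
`(gh)^({i,k}) = ĝ({i}) ĥ({k}) + ĝ({k}) ĥ({i})` (`i ≠ k`). [cite: ODonnell2014, §1.4] -/
theorem fc_mul_pair {g h : (Fin N → Bool) → ℝ}
    (hg : ∀ S : Finset (Fin N), 2 ≤ S.card → cubeFourierCoeff g S = 0)
    (hh : ∀ S : Finset (Fin N), 2 ≤ S.card → cubeFourierCoeff h S = 0) {i k : Fin N} (hik : i ≠ k) :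
    cubeFourierCoeff (fun x => g x * h x) {i, k} =
      cubeFourierCoeff g {i} * cubeFourierCoeff h {k} + cubeFourierCoeff g {k} * cubeFourierCoeff h {i} := by
  classical
  rw [cubeFourierCoeff_mul]
  have hne : ({i} : Finset (Fin N)) ≠ {k} := by
    intro e; exact hik (Finset.singleton_injective e)
  rw [← Finset.sum_subset (Finset.subset_univ ({{i}, {k}} : Finset (Finset (Fin N)))),
    Finset.sum_pair hne, singleton_symmDiff_pair hik, singleton_symmDiff_pair' hik]
  intro S _ hS
  rw [Finset.mem_insert, Finset.mem_singleton, not_or] at hS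
  by_cases h2 : 2 ≤ S.card
  · rw [hg S h2, zero_mul]
  · by_cases h0 : S.card = 0
    · rw [Finset.card_eq_zero] at h0
      subst h0
      rw [hh _ (by rw [show (∅ : Finset (Fin N)) ∆ {i, k} = {i, k} from bot_symmDiff _,
        Finset.card_pair hik]), mul_zero]
    · have hc : S.card = 1 := by omega
      obtain ⟨l, rfl⟩ := Finset.card_eq_one.mp hc
      have hl1 : l ≠ i := fun e => hS.1 (by rw [e])
      have hl2 : l ≠ k := fun e => hS.2 (by rw [e])
      rw [hh _ ((card_singleton_symmDiff_pair hik hl1 hl2).trans' (by norm_num)), mul_zero]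

/-- Convolution at `∅`: `(gh)^(∅) = Σ_S ĝ(S) ĥ(S)`. [cite: ODonnell2014, §1.4] -/
theorem fc_mul_empty (g h : (Fin N → Bool) → ℝ) :
    cubeFourierCoeff (fun x => g x * h x) ∅ = ∑ S, cubeFourierCoeff g S * cubeFourierCoeff h S := by
  rw [cubeFourierCoeff_mul]
  refine Finset.sum_congr rfl fun S _ => ?_
  rw [show S ∆ (∅ : Finset (Fin N)) = S from symmDiff_bot S]

/-- The constant function `1` has coefficients `[S = ∅]`. [folklore] -/
theorem fc_one (S : Finset (Fin N)) :
    cubeFourierCoeff (fun _ : Fin N → Bool => (1 : ℝ)) S = if S = ∅ then 1 else 0 := by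
  have e : (walsh (∅ : Finset (Fin N)) : (Fin N → Bool) → ℝ) = fun _ => 1 :=
    funext fun x => walsh_empty x
  rw [← e, cubeFourierCoeff_walsh]
  by_cases h : S = ∅
  · subst h; simp
  · simp [h, Ne.symm h]


/-! ### Sums over the low Fourier levels -/

/-- A function of finite sets vanishing at sets of size `≥ 2` sums to its values at `∅` and the
singletons. [folklore] -/
theorem sum_level_le_one (f : Finset (Fin N) → ℝ) (hf : ∀ S, 2 ≤ S.card → f S = 0) :
    ∑ S, f S = f ∅ + ∑ k, f {k} := by
  classical
  have himg : (Finset.univ : Finset (Fin N)).image (fun k => ({k} : Finset (Fin N))) =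
      Finset.univ.filter (fun S : Finset (Fin N) => S.card = 1) := by
    ext S
    simp only [Finset.mem_image, Finset.mem_univ, true_and, Finset.mem_filter, Finset.card_eq_one]
    constructor
    · rintro ⟨k, rfl⟩; exact ⟨k, rfl⟩
    · rintro ⟨k, rfl⟩; exact ⟨k, rfl⟩
  have hsplit : ∑ S, f S = ∑ S ∈ Finset.univ.filter (fun S : Finset (Fin N) => S.card ≤ 1), f S := by
    rw [← Finset.sum_filter_add_sum_filter_not Finset.univ (fun S : Finset (Fin N) => S.card ≤ 1) f]
    have hz : ∑ S ∈ Finset.univ.filter (fun S : Finset (Fin N) => ¬ S.card ≤ 1), f S = 0 :=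
      Finset.sum_eq_zero fun S hS => by
        rw [Finset.mem_filter] at hS
        exact hf S (by omega)
    rw [hz, add_zero]
  have hsplit2 : Finset.univ.filter (fun S : Finset (Fin N) => S.card ≤ 1) =
      insert ∅ (Finset.univ.filter (fun S : Finset (Fin N) => S.card = 1)) := by
    ext S
    simp only [Finset.mem_filter, Finset.mem_univ, true_and, Finset.mem_insert]
    constructor
    · intro h
      by_cases h0 : S.card = 0
      · exact Or.inl (Finset.card_eq_zero.mp h0)
      · exact Or.inr (by omega)
    · rintro (rfl | h)
      · simp
      · omega
  rw [hsplit, hsplit2, Finset.sum_insert, ← himg, Finset.sum_image]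
  · intro a _ b _ hab
    exact Finset.singleton_injective hab
  · simp

/-- The sets of size `2` containing `i` are the `{i, k}`, `k ≠ i`. [folklore] -/
theorem sum_pairs_containing (i : Fin N) (f : Finset (Fin N) → ℝ) :
    ∑ S ∈ Finset.univ.filter (fun S : Finset (Fin N) => S.card = 2 ∧ i ∈ S), f S =
      ∑ k ∈ Finset.univ.erase i, f {i, k} := by
  classical
  have himg : (Finset.univ.erase i).image (fun k => ({i, k} : Finset (Fin N))) =
      Finset.univ.filter (fun S : Finset (Fin N) => S.card = 2 ∧ i ∈ S) := by
    ext S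
    simp only [Finset.mem_image, Finset.mem_erase, Finset.mem_univ, and_true, Finset.mem_filter,
      true_and]
    constructor
    · rintro ⟨k, hk, rfl⟩
      exact ⟨Finset.card_pair (Ne.symm hk), by simp⟩
    · rintro ⟨h2, hi⟩
      obtain ⟨x, y, hxy, rfl⟩ := Finset.card_eq_two.mp h2
      rw [Finset.mem_insert, Finset.mem_singleton] at hi
      rcases hi with rfl | rfl
      · exact ⟨y, hxy.symm, rfl⟩
      · exact ⟨x, hxy, Finset.pair_comm i x⟩
  rw [← himg, Finset.sum_image]
  intro a ha b hb hab
  have ha' : a ≠ i := by simpa using ha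
  -- {i,a} = {i,b} with a,b ≠ i ⇒ a = b
  have hab' : ({i, a} : Finset (Fin N)) = {i, b} := hab
  have : a ∈ ({i, b} : Finset (Fin N)) := by rw [← hab']; simp
  rw [Finset.mem_insert, Finset.mem_singleton] at this
  rcases this with h | h
  · exact absurd h ha'
  · exact h

/-- Double counting over sets of size two: `2 Σ_{|S|=2} f(S) = Σ_i Σ_{k ≠ i} f({i,k})`. [folklore] -/
theorem two_mul_sum_card_two (f : Finset (Fin N) → ℝ) :
    2 * ∑ S ∈ Finset.univ.filter (fun S : Finset (Fin N) => S.card = 2), f S =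
      ∑ i, ∑ k ∈ Finset.univ.erase i, f {i, k} := by
  classical
  simp_rw [← sum_pairs_containing]
  rw [Finset.mul_sum]
  -- rewrite both sides as a sum over S with indicators
  have e1 : ∀ i : Fin N, ∑ S ∈ Finset.univ.filter (fun S : Finset (Fin N) => S.card = 2 ∧ i ∈ S), f S =
      ∑ S ∈ Finset.univ.filter (fun S : Finset (Fin N) => S.card = 2), (if i ∈ S then f S else 0) := by
    intro i
    rw [Finset.sum_filter, Finset.sum_filter]
    refine Finset.sum_congr rfl fun S _ => ?_
    by_cases h1 : S.card = 2 <;> by_cases h2 : i ∈ S <;> simp [h1, h2]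
  simp_rw [e1]
  rw [Finset.sum_comm]
  refine Finset.sum_congr rfl fun S hS => ?_
  rw [Finset.mem_filter] at hS
  rw [Finset.sum_ite_mem, Finset.univ_inter, Finset.sum_const, hS.2, nsmul_eq_mul]
  norm_num

/-- **Variance in the Walsh basis**: `Var[p] = Σ_{S ≠ ∅} p̂(S)²`. [cite: ODonnell2014, §1.4] -/
theorem boolVariance_eq_sum_sq_fourier (p : MvPolynomial (Fin N) ℝ) :
    boolVariance p = ∑ S : Finset (Fin N),
      (if S = ∅ then 0 else cubeFourierCoeff (evalBool p) S ^ 2) := by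
  classical
  set c := boolAvg (evalBool p) with hc
  have hpar := sum_cubeFourierCoeff_sq (m := N) (fun x => evalBool p x - c)
  have hcoef : ∀ S : Finset (Fin N), cubeFourierCoeff (fun x => evalBool p x - c) S =
      cubeFourierCoeff (evalBool p) S - (if S = ∅ then c else 0) := by
    intro S
    rw [show (fun x => evalBool p x - c) = (fun x => evalBool p x - (fun _ => c) x) from rfl, cubeFourierCoeff_sub]
    congr 1
    have : (fun _ : Fin N → Bool => c) = fun x => c * (fun _ => (1 : ℝ)) x := by funext x; simp
    rw [this, cubeFourierCoeff_const_mul, fc_one]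
    split_ifs <;> simp
  have hV : boolVariance p = (∑ x, (evalBool p x - c) ^ 2) / 2 ^ N := rfl
  rw [hV, ← hpar]
  refine Finset.sum_congr rfl fun S _ => ?_
  rw [hcoef]
  by_cases hS : S = ∅
  · subst hS
    rw [if_pos rfl, if_pos rfl, hc, boolAvg_evalBool_eq_fourier_empty, sub_self]
    ring
  · rw [if_neg hS, if_neg hS, sub_zero]


/-! ### The flat-Gram-matrix argument -/

/-- An elementary discriminant step: if `2 s S₀ ≤ D + s² B` for all real `s`, with `S₀, B ≥ 0`, then
`S₀² ≤ D·B`. [folklore] -/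
theorem sq_le_of_forall_quadratic {S₀ D B : ℝ} (hS : 0 ≤ S₀) (hB : 0 ≤ B)
    (h : ∀ s : ℝ, 2 * s * S₀ ≤ D + s ^ 2 * B) : S₀ ^ 2 ≤ D * B := by
  by_cases hB0 : B = 0
  · subst hB0
    by_cases hS0 : S₀ = 0
    · subst hS0; simp
    · have hSpos : 0 < S₀ := lt_of_le_of_ne hS (Ne.symm hS0)
      have h1 := h ((D + 1) / S₀)
      have : 2 * ((D + 1) / S₀) * S₀ = 2 * (D + 1) := by field_simp
      rw [this] at h1
      have hD : 0 ≤ D := by have := h 0; simpa using this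
      nlinarith
  · have hBpos : 0 < B := lt_of_le_of_ne hB (Ne.symm hB0)
    have hB0' : B ≠ 0 := hB0
    have h1 := h (S₀ / B)
    have h2 : 2 * (S₀ / B) * S₀ * B ≤ (D + (S₀ / B) ^ 2 * B) * B :=
      mul_le_mul_of_nonneg_right h1 hB
    have e1 : 2 * (S₀ / B) * S₀ * B = 2 * S₀ ^ 2 := by field_simp
    have e2 : (D + (S₀ / B) ^ 2 * B) * B = D * B + S₀ ^ 2 := by field_simp
    rw [e1, e2] at h2
    linarith

/-- From `ρ² ≤ d·B` (all nonnegative) and `λ > 0`: `2ρ ≤ λ d + B/λ` (AM–GM). [folklore] -/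
theorem two_mul_le_of_sq_le {ρ d B lam : ℝ} (hρ : 0 ≤ ρ) (hd : 0 ≤ d) (hB : 0 ≤ B) (hlam : 0 < lam)
    (h : ρ ^ 2 ≤ d * B) : 2 * ρ ≤ lam * d + B / lam := by
  have hR : 0 ≤ lam * d + B / lam := by positivity
  have key : (2 * ρ) ^ 2 ≤ (lam * d + B / lam) ^ 2 := by
    have e : (lam * d + B / lam) ^ 2 = (lam * d - B / lam) ^ 2 + 4 * (d * B) := by
      field_simp; ring
    rw [e]
    nlinarith [sq_nonneg (lam * d - B / lam)]
  exact (pow_le_pow_iff_left₀ (by positivity) hR (by norm_num : (2 : ℕ) ≠ 0)).mp key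

/-- **Flat Gram matrix ⇒ `M ≼ D`** on level-`≤ 1` test vectors: if the mixed Gram sums of the
coefficient families `α, γ` vanish off the diagonal (`flatness`), then
`Σ_j (c₀ α_j(∅) + Σ_k c_k α_j({k}))² ≤ c₀² d(∅) + Σ_k c_k² d({k})` with `d(S) = Σ_j (α_j(S)² + γ_j(S)²)`.
[folklore] -/
theorem quad_le_of_flat {m : ℕ} (α γ : Fin m → Finset (Fin N) → ℝ) (d : Finset (Fin N) → ℝ)
    (hdS : ∀ S, d S = ∑ j, (α j S ^ 2 + γ j S ^ 2))
    (hflat1 : ∀ i, ∑ j, (α j ∅ * α j {i} + γ j ∅ * γ j {i}) = 0)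
    (hflat2 : ∀ i k, i ≠ k → ∑ j, (α j {i} * α j {k} + γ j {i} * γ j {k}) = 0)
    (c₀ : ℝ) (c : Fin N → ℝ) :
    ∑ j, (c₀ * α j ∅ + ∑ k, c k * α j {k}) ^ 2 ≤ c₀ ^ 2 * d ∅ + ∑ k, c k ^ 2 * d {k} := by
  have T1 : ∑ j, c₀ ^ 2 * (α j ∅ ^ 2 + γ j ∅ ^ 2) = c₀ ^ 2 * d ∅ := by rw [← Finset.mul_sum, hdS]
  have T2 : ∑ j, (α j ∅ * (∑ k, c k * α j {k}) + γ j ∅ * (∑ k, c k * γ j {k})) = 0 := by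
    have e : ∀ j, α j ∅ * (∑ k, c k * α j {k}) + γ j ∅ * (∑ k, c k * γ j {k}) =
        ∑ k, c k * (α j ∅ * α j {k} + γ j ∅ * γ j {k}) := by
      intro j; rw [Finset.mul_sum, Finset.mul_sum, ← Finset.sum_add_distrib]
      exact Finset.sum_congr rfl fun k _ => by ring
    simp_rw [e]; rw [Finset.sum_comm]
    refine Finset.sum_eq_zero fun k _ => ?_
    rw [← Finset.mul_sum, hflat1 k, mul_zero]
  have T3 : ∑ j, ((∑ k, c k * α j {k}) * (∑ k, c k * α j {k}) +
      (∑ k, c k * γ j {k}) * (∑ k, c k * γ j {k})) = ∑ k, c k ^ 2 * d {k} := by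
    have e : ∀ j, (∑ k, c k * α j {k}) * (∑ k, c k * α j {k}) +
        (∑ k, c k * γ j {k}) * (∑ k, c k * γ j {k}) =
        ∑ k, ∑ l, c k * c l * (α j {k} * α j {l} + γ j {k} * γ j {l}) := by
      intro j; rw [Finset.sum_mul_sum, Finset.sum_mul_sum, ← Finset.sum_add_distrib]
      refine Finset.sum_congr rfl fun k _ => ?_
      rw [← Finset.sum_add_distrib]; exact Finset.sum_congr rfl fun l _ => by ring
    simp_rw [e]
    rw [Finset.sum_comm]
    refine Finset.sum_congr rfl fun k _ => ?_
    rw [Finset.sum_comm]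
    have e2 : ∀ l, ∑ j, c k * c l * (α j {k} * α j {l} + γ j {k} * γ j {l}) =
        c k * c l * ∑ j, (α j {k} * α j {l} + γ j {k} * γ j {l}) := fun l => by rw [Finset.mul_sum]
    simp_rw [e2]
    rw [Finset.sum_eq_single k]
    · rw [hdS, sq]; congr 1; exact Finset.sum_congr rfl fun j _ => by ring
    · intro l _ hlk; rw [hflat2 k l (Ne.symm hlk), mul_zero]
    · intro h; exact absurd (Finset.mem_univ k) h
  have hsum : ∑ j, ((c₀ * α j ∅ + ∑ k, c k * α j {k}) ^ 2 + (c₀ * γ j ∅ + ∑ k, c k * γ j {k}) ^ 2) =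
      c₀ ^ 2 * d ∅ + ∑ k, c k ^ 2 * d {k} := by
    have e1 : ∀ j, (c₀ * α j ∅ + ∑ k, c k * α j {k}) ^ 2 + (c₀ * γ j ∅ + ∑ k, c k * γ j {k}) ^ 2 =
        c₀ ^ 2 * (α j ∅ ^ 2 + γ j ∅ ^ 2)
        + 2 * c₀ * (α j ∅ * (∑ k, c k * α j {k}) + γ j ∅ * (∑ k, c k * γ j {k}))
        + ((∑ k, c k * α j {k}) * (∑ k, c k * α j {k}) +
            (∑ k, c k * γ j {k}) * (∑ k, c k * γ j {k})) := by
      intro j; ring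
    simp_rw [e1]
    rw [Finset.sum_add_distrib, Finset.sum_add_distrib, T1, ← Finset.mul_sum, T2, T3]; ring
  calc ∑ j, (c₀ * α j ∅ + ∑ k, c k * α j {k}) ^ 2
      ≤ ∑ j, ((c₀ * α j ∅ + ∑ k, c k * α j {k}) ^ 2 + (c₀ * γ j ∅ + ∑ k, c k * γ j {k}) ^ 2) :=
        Finset.sum_le_sum fun j _ => by nlinarith [sq_nonneg (c₀ * γ j ∅ + ∑ k, c k * γ j {k})]
    _ = _ := hsum

end Summit.QuantumAdvantage.QuantumAdvantage.Theorems.SosSandwich
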